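import Literature.AlgebraicGeometry.HodgeTheory.QuaternionicQuarticDoublePlaneModel
import Literature.AlgebraicGeometry.HodgeTheory.QuaternionicQuarticDeckChartIntegral
import HarnessLib

/-!
# The GENERIC quaternionic quartic surface is birational to the generic double plane — unconditionally

Layer `Literature/AlgebraicGeometry/HodgeTheory`. Theorems only; no named fact, no definition. Sequel of
`QuaternionicQuarticDoublePlaneModel` (birationality `Spec DeckRing ~ Spec DoublePlaneRing` over a field under
`a₀² ≠ a₁²`, `ψ(u₀,u₁,1) ≠ 0`, integral deck chart) and of the tree's `QuaternionicQuarticDeckChartIntegral`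
(`isDomain_deckRing_of_injective`: the deck chart is integral at every INJECTIVE point `φ : A ↪ L` of the parameter ring
`A = ℂ[a]`, e.g. the generic point `A ↪ Frac A`). Written by the prover seat `leafhand-hodge-q8symplecticpowers-4` (g4, cell
`pub-hsemireg`) for route `HodgeConjecture/Q8SymplecticPowers` (crux K1Q, stmt-HodgeConjecture-24190), brick **Zb-3** of the
S1 programme (`stub_regularVeryGeneralQ`).

At an injective point every genericity hypothesis of the double-plane bridge HOLDS:
* `aLin_sq_sub_sq_ne_zero`, `det_aφ_ne_zero` — `a₀² − a₁² ≠ 0` (distinct variables of `A`, injectivity of `φ`);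
* `ψ₂_aφ_ne_zero` — `ψ(u₀, u₁, 1) ≠ 0` (the tree's witness `eval_zφ_ψ₂_ne_zero`, `e ≥ 2`);
so (`isDomain_doublePlaneRing_of_injective`) **the double-plane chart ring `DoublePlaneRing a_φ` is a DOMAIN**,
(`birationalOver_spec_doublePlane_of_injective`) `Spec (DeckRing a_φ) ~bir Spec (DoublePlaneRing a_φ)` over `L`, and
(`birationalOver_fiberSch_doublePlane_of_injective`) **the fibre `𝒱_φ` of the universal quaternionic quartic (the generic
surface `x₃⁴x₂^{2e} = c(σc)³((x₀ − x₁)ψ)²` for `φ = A ↪ Frac A`) is birational over `L` to the double plane `t² = s·α·ψ`** —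
with NO hypothesis beyond `e ≥ 2` and injectivity. This is the generic-point input of a spreading-out argument for S1
(`b₁` of the desingularised double plane = `b₁` of the models of `V_(c,ψ)` on a dense open of parameters).

Honest scope: birational bookkeeping; nothing here bears on HC; S1 ∕ K1Q NOT proved.

## References

* [Zariski1929] O. Zariski, On the linear connection index of the algebraic surfaces zⁿ = f(x, y), PNAS 15 (1929).
* [EGAIV3] A. Grothendieck, J. Dieudonné, EGA IV₃ (1966), §8 (generic fibre and spreading out).
* [GortzWedhorn2020] U. Görtz, T. Wedhorn, Algebraic Geometry I, 2nd ed. (2020), Prop. 4.32 (2).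
* [Lang2002] S. Lang, Algebra (3rd ed., 2002), Ch. IV §1 (algebraic independence of the variables).
-/

noncomputable section

open MvPolynomial CategoryTheory AlgebraicGeometry
open Literature.AlgebraicGeometry.Motives

namespace Literature.AlgebraicGeometry.HodgeTheory.Q8Family

section GenericPoint

variable (e : ℕ)

/-- `a₀² − a₁² ≠ 0` in the parameter ring `A = ℂ[a]` (evaluate at `a₀ = 1`, all other coordinates `0`).
[cite: Lang2002, Ch. IV §1 (polynomial rings: the variables are algebraically independent)] -/
theorem aLin_sq_sub_sq_ne_zero : aLin e 0 ^ 2 - aLin e 1 ^ 2 ≠ 0 := by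
  classical
  intro h
  have hne : (Sum.inl (linIdx 1) : CIdx e) ≠ Sum.inl (linIdx 0) := fun h'' =>
    absurd (linIdx_injective (Sum.inl_injective h'')) (by decide)
  have h' := congrArg (MvPolynomial.eval (fun i : CIdx e => if i = Sum.inl (linIdx 0) then (1 : ℂ) else 0)) h
  simp [aLin, hne] at h'

variable {e} {L : Type} [Field L] (φ : ParamRing e →+* L) (hφ : Function.Injective φ)
include hφ

/-- At an injective point, `a₀² − a₁² ≠ 0` in `L`. [cite: Lang2002, Ch. IV §1 (polynomial rings: the variables are algebraically independent)] -/
theorem det_aφ_ne_zero : coefLin (aφ φ) 0 ^ 2 - coefLin (aφ φ) 1 ^ 2 ≠ 0 := by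
  change φ (aLin e 0) ^ 2 - φ (aLin e 1) ^ 2 ≠ 0
  rw [← map_pow, ← map_pow, ← map_sub]
  exact (map_ne_zero_iff φ hφ).mpr (aLin_sq_sub_sq_ne_zero e)

/-- At an injective point, `ψ(u₀, u₁, 1) ≠ 0` (`e ≥ 2`). [cite: Kollar2007, §3.3] -/
theorem ψ₂_aφ_ne_zero (he : 2 ≤ e) : ψ₂ (aφ φ) ≠ 0 := fun h =>
  eval_zφ_ψ₂_ne_zero φ hφ he ((map_ne_zero_iff φ hφ).mpr (aLin_ne_zero e 0)) (by rw [h, map_zero])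

variable [Algebra ℂ L]

/-- **The double-plane chart ring is a DOMAIN at every injective point** of the parameter ring (in particular at the
generic point): the generic double plane `t² = s·α·ψ` is an integral surface. [cite: Zariski1929] [cite: EGAIV3, §8] -/
theorem isDomain_doublePlaneRing_of_injective (he : 2 ≤ e) : IsDomain (DoublePlaneRing (aφ φ)) := by
  haveI := isDomain_deckRing_of_injective φ hφ he
  exact isDomain_doublePlaneRing_of_field (aφ φ) (det_aφ_ne_zero φ hφ) (ψ₂_aφ_ne_zero φ hφ he)

/-- **`Spec (DeckRing a_φ) ~bir Spec (DoublePlaneRing a_φ)` over `L` at every injective point.**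
[cite: GortzWedhorn2020, Prop. 4.32 (2)] [cite: Zariski1929] -/
theorem birationalOver_spec_doublePlane_of_injective (he : 2 ≤ e) :
    Scheme.BirationalOver (Spec.map (CommRingCat.ofHom (algebraMap L (DeckRing (aφ φ)))))
      (Spec.map (CommRingCat.ofHom (algebraMap L (DoublePlaneRing (aφ φ))))) := by
  haveI := isDomain_deckRing_of_injective φ hφ he
  exact birationalOver_spec_doublePlane_of_field (aφ φ) (det_aφ_ne_zero φ hφ) (ψ₂_aφ_ne_zero φ hφ he)

end GenericPoint

section GenericFibre

variable (e : ℕ) {L : Type} [Field L] [Algebra (ParamRing e) L] [Algebra ℂ L]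

/-- **The fibre of the universal quaternionic quartic at an injective point is birational to the double plane** — for
`φ = algebraMap A L` injective (e.g. `L = Frac A`, the GENERIC surface) and `e ≥ 2`:
`Spec (DoublePlaneRing a_φ) ~bir 𝒱_φ` over `Spec L`, unconditionally. [cite: Zariski1929] [cite: EGAIV3, §8]
[cite: GortzWedhorn2020, Prop. 4.32 (2)] -/
theorem birationalOver_fiberSch_doublePlane_of_injective (he : 2 ≤ e)
    (hφ : Function.Injective (algebraMap (ParamRing e) L)) :
    Scheme.BirationalOver
      (Spec.map (CommRingCat.ofHom (algebraMap L (DoublePlaneRing (algebraMap (ParamRing e) L ∘ univCoeffs e)))))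
      (fiberSch e (algebraMap (ParamRing e) L)).hom := by
  have he1 : 1 ≤ e := by omega
  have hG : algebraMap (ParamRing e) L (genericityElem e) ≠ 0 :=
    (map_ne_zero_iff _ hφ).mpr (genericityElem_ne_zero e he)
  haveI : IsDomain (DeckRing (algebraMap (ParamRing e) L ∘ univCoeffs e)) :=
    isDomain_deckRing_of_injective (algebraMap (ParamRing e) L) hφ he
  have h1 := birationalOver_deckChart_fiberSch e (L := L) he1 hG
  have h2 : Scheme.BirationalOver
      (Spec.map (CommRingCat.ofHom (algebraMap L (DeckRing (algebraMap (ParamRing e) L ∘ univCoeffs e)))))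
      (Spec.map (CommRingCat.ofHom (algebraMap L (DoublePlaneRing (algebraMap (ParamRing e) L ∘ univCoeffs e))))) :=
    birationalOver_spec_doublePlane_of_injective (algebraMap (ParamRing e) L) hφ he
  exact h2.symm.trans h1

end GenericFibre

end Literature.AlgebraicGeometry.HodgeTheory.Q8Family

end
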